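import Summits.MatrixMultiplication.OmegaCensus.STPPCriticalPairsZ46Blocks

/-!
# ω-census (abelian STPP census): `{(2,2,3),(3,3,2),(3,3,2)}` in `ℤ/46ℤ` — the branch «both `C₁`, `C₂` are `K`-cosets» is empty (kernel)

HONEST FRAMING (pub-omega census; verbatim): lottery ticket; floor = certified bounds/negative ranges.
Census STRUCTURE (seat pub-omega-stpp-2 gen 32, 2026-08-30), family (b2).  First clash file of the case map HOME `pub-omega-stpp-2-g32/CASEMAP.md`:
by `blockC_structure` each two-element set `Cᵢ` (`i = 1, 2`) is `{c, c + d}` with `X°ᵢ` a `13`-progression of step `d`, or a `K`-coset `{c, c + 23}`.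
Here: **if `Cᵢ` is a `K`-coset then the difference set `X_{i′} = B_{i′} − A_{i′}` of the OTHER `(3,3,2)` block meets at most `14 − 9 = 5` new
`K`-cosets: `|X_{i′} ∪ (X_{i′} + 23)| ≤ 14`** (`card_union_vadd23_le_of_coset`; the inner critical pair `(−Cᵢ, X°ᵢ)` has `14` elements and contains
`−c + (X_{i′} ∪ (X_{i′} + 23))`), whereas **if `C_{i′}` is a `K`-coset too, the TPP of block `i′` makes `X_{i′}` and `X_{i′} + 23` disjoint**, so
`|X_{i′} ∪ (X_{i′} + 23)| = 18` — contradiction (`not_coset_coset`).  Nothing here is progress on `ω`.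

References: H. Cohn, R. Kleinberg, B. Szegedy, C. Umans, FOCS 2005 (arXiv:math/0511460), Def. 5.1; M. Kneser, Math. Z. 58 (1953) (through the tools).
-/

open Finset
open scoped Pointwise

namespace Summit.MatrixMultiplication.OmegaCensus.Z46

open Literature.Computability.AlgebraicComplexity
open Literature.Combinatorics.Additive
open Summit.MatrixMultiplication.OmegaCensus.STPPKneser
open Summit.MatrixMultiplication.OmegaCensus.CubeNB

variable {A B C : Fin 3 → Finset (ZMod 46)}

/-- The inner critical pair of the `(C,A,B)` reading at a `(3,3,2)` block `i`: `|(−Cᵢ) + X°ᵢ| = 14`. [cite: Kneser1953] [cite: CohnKleinbergSzegedyUmans2005, Def. 5.1] -/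
theorem card_negC_add_DU (hS : IsSTPP A B C) (hA : ∀ i, #(A i) = ![2, 3, 3] i) (hB : ∀ i, #(B i) = ![2, 3, 3] i)
    (hC : ∀ i, #(C i) = ![3, 2, 2] i) (i : Fin 3) (hi : i ≠ 0) :
    #((C i).image (fun x => (0 : ZMod 46) - x) + DU A B (univ.erase i)) = 14 := by
  have hAne : ∀ i, (A i).Nonempty := fun i => card_pos.1 (by rw [hA]; fin_cases i <;> simp)
  have hBne : ∀ i, (B i).Nonempty := fun i => card_pos.1 (by rw [hB]; fin_cases i <;> simp)
  have hCne : ∀ i, (C i).Nonempty := fun i => card_pos.1 (by rw [hC]; fin_cases i <;> simp)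
  have hAi : #(A i) = 3 := by rw [hA]; fin_cases i <;> simp at hi ⊢
  have hBi : #(B i) = 3 := by rw [hB]; fin_cases i <;> simp at hi ⊢
  have hCi : #(C i) = 2 := by rw [hC]; fin_cases i <;> simp at hi ⊢
  have hI : (univ.erase i : Finset (Fin 3)).Nonempty := ⟨0, Finset.mem_erase.2 ⟨hi.symm, Finset.mem_univ _⟩⟩
  have hL : ∑ k ∈ univ.erase i, #(A k) * #(B k) = 13 := by
    fin_cases i <;> simp at hi ⊢ <;> simp only [hA, hB] <;> decide
  have hz : ∑ k ∈ univ.erase i, #(C k) * #(B k) = 12 := by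
    fin_cases i <;> simp at hi ⊢ <;> simp only [hB, hC] <;> decide
  exact inner_critical_of_n18_tight (stpp_rotate (stpp_rotate hS)) hCne hAne hBne i hI (ZMod.card 46) (a := 2) (b := 3) (vol := 18)
    (L := 13) (z := 12) hCi hAi (by rw [hAi, hBi, hCi]) hL hz (by decide)

/-- **If `Cᵢ` is a `K`-coset, the other big block's difference set `X_j = B_j − A_j` (`j ≠ 0, i`) has `|X_j ∪ (X_j + 23)| ≤ 14`.**
[cite: Kneser1953] [cite: CohnKleinbergSzegedyUmans2005, Def. 5.1] -/
theorem card_union_vadd23_le_of_coset (hS : IsSTPP A B C) (hA : ∀ i, #(A i) = ![2, 3, 3] i) (hB : ∀ i, #(B i) = ![2, 3, 3] i)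
    (hC : ∀ i, #(C i) = ![3, 2, 2] i) {i j : Fin 3} (hi : i ≠ 0) (hji : j ≠ i) {c : ZMod 46} (hCi : C i = {c, c + 23}) :
    #(D A B j ∪ ((23 : ZMod 46) +ᵥ D A B j)) ≤ 14 := by
  have h14 := card_negC_add_DU hS hA hB hC i hi
  -- `−c + (X_j ∪ (X_j + 23)) ⊆ (−Cᵢ) + X°ᵢ`
  have hsub : (-c - 23) +ᵥ (D A B j ∪ ((23 : ZMod 46) +ᵥ D A B j)) ⊆ (C i).image (fun x => (0 : ZMod 46) - x) + DU A B (univ.erase i) := by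
    intro x hx
    obtain ⟨y, hy, rfl⟩ := Finset.mem_vadd_finset.1 hx
    have hjI : j ∈ univ.erase i := Finset.mem_erase.2 ⟨hji, Finset.mem_univ _⟩
    rcases Finset.mem_union.1 hy with hyX | hy23
    · refine Finset.mem_add.2 ⟨0 - (c + 23), Finset.mem_image.2 ⟨c + 23, by rw [hCi]; simp, rfl⟩, y,
        Finset.mem_biUnion.2 ⟨j, hjI, hyX⟩, ?_⟩
      simp only [vadd_eq_add]; abel
    · obtain ⟨z, hz, rfl⟩ := Finset.mem_vadd_finset.1 hy23
      refine Finset.mem_add.2 ⟨0 - c, Finset.mem_image.2 ⟨c, by rw [hCi]; simp, rfl⟩, z, Finset.mem_biUnion.2 ⟨j, hjI, hz⟩, ?_⟩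
      simp only [vadd_eq_add]
      rw [show (-c - 23 : ZMod 46) = -c + 23 by rw [sub_eq_add_neg, (by decide : -(23 : ZMod 46) = 23)]]
      abel
  have := Finset.card_le_card hsub
  rwa [Finset.card_vadd_finset, h14] at this

/-- **The TPP of a block whose `C`-set is a `K`-coset separates `X` from `X + 23`.** [cite: CohnKleinbergSzegedyUmans2005, Def. 5.1] -/
theorem disjoint_D_vadd23_of_coset (hS : IsSTPP A B C) {j : Fin 3} {c : ZMod 46} (hCj : C j = {c, c + 23}) :
    Disjoint (D A B j) ((23 : ZMod 46) +ᵥ D A B j) := by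
  rw [Finset.disjoint_left]
  intro x hx hx'
  obtain ⟨y, hy, rfl⟩ := Finset.mem_vadd_finset.1 hx'
  obtain ⟨a, ha, b, hb, hab⟩ := mem_D.1 hx
  obtain ⟨a', ha', b', hb', rfl⟩ := mem_D.1 hy
  -- word `(a' − a) + (b − b') + (c − (c + 23)) = 0` in block `j`
  have hc : c ∈ C j := by rw [hCj]; simp
  have hc' : c + 23 ∈ C j := by rw [hCj]; simp
  have hw : (a' - a) + (b - b') + (c - (c + 23)) = 0 := by
    have e : b - a = 23 + (b' - a') := by rw [hab, vadd_eq_add]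
    have e2 : (a' - a) + (b - b') + (c - (c + 23)) = (b - a) - (b' - a') - 23 := by abel
    rw [e2, e]
    abel
  obtain ⟨-, -, -, -, h⟩ := hS j j j a ha a' ha' b' hb' b hb (c + 23) hc' c hc hw
  exact absurd h (by
    intro h'
    have h46 : (23 : ZMod 46) = 0 := by
      have := congrArg (fun y => y - c) h'
      simp only [add_sub_cancel_left, sub_self] at this
      exact this
    exact absurd h46 (by decide))

/-- **Branch «`C₁` and `C₂` both `K`-cosets» is empty.** [cite: CohnKleinbergSzegedyUmans2005, Def. 5.1] [cite: Kneser1953] -/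
theorem not_coset_coset (hS : IsSTPP A B C) (hA : ∀ i, #(A i) = ![2, 3, 3] i) (hB : ∀ i, #(B i) = ![2, 3, 3] i)
    (hC : ∀ i, #(C i) = ![3, 2, 2] i) {c₁ c₂ : ZMod 46} (h1 : C 1 = {c₁, c₁ + 23}) (h2 : C 2 = {c₂, c₂ + 23}) : False := by
  have hCne : ∀ i, (C i).Nonempty := fun i => card_pos.1 (by rw [hC]; fin_cases i <;> simp)
  have hle := card_union_vadd23_le_of_coset hS hA hB hC (i := 1) (j := 2) (by decide) (by decide) h1
  have hdis := disjoint_D_vadd23_of_coset hS h2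
  have hX2 : #(D A B 2) = 9 := by rw [card_D_AB hS hCne 2, hA, hB]; rfl
  rw [Finset.card_union_of_disjoint hdis, Finset.card_vadd_finset, hX2] at hle
  omega

end Summit.MatrixMultiplication.OmegaCensus.Z46
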